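import Summits.QuantumFields.YangMills.Theorems.BalabanUVNodesN11Sect3SupplySplice

/-!
# DAG node N11 — [III] §3's SUPPLY AT LEVEL `0` IS A WITNESS-FREE, PRINT-SHAPED TARGET: `FirstStepSupplyAt θ p` (the FIRST small-field step — [I] Thm 1 + [II] —
# read at def-T's level-1 objects of record) and `Sect3SpliceSupplyAt θ p 0 ↔ FirstStepSupplyAt θ p` (generic `θ : Stage13HParams`); hence `ρ₁`'s §2 form at the
# re-pinned door of the cured witness of record from `FirstStepSupplyAt` and `0 < K` ALONE

HEADER — WORK-UNIT METADATA.  Cell `pub-ymgap`, YM-PLAN Track A (HUMAN RULING D-0062 ∕ D-0149 width push), seat `pub-ymgap-dag-n08-w2` (g0; WIDTH SEAT re-pointed by the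
dag-lead desk to N11's §3-supply residue, DEDUP-354∕355; hand-out «w2 take X» of dag-n11-e g15, INBOX 2026-08-27T23:21:49Z), route `BalabanUVNodes` rev 25 (v1.7 `CoPH` key),
item K1⁷ `StabilityBAtRecordR13SepCoPH` = stmt-QuantumFields-20542; DEFINITION lane (`--supports 20542 --as helper`), count-neutral.  [III] = [Balaban1988Convergent],
[I] = [Balaban1987RG1], [II] = [Balaban1988RG2Cluster].  Over dag-n11-e's `…Sect3SupplySpliceDefs` (`graftAbove`, `Sect3SpliceSupplyAt`), `…Sect3SupplySplice`
(`sLaw₁₃CoPH_one_rePinH_doorCured_theta13LiveOfRecord_of_spliceSupply_zero`), `…NoExpansionTruncatedWitness` (p549689: `action23_actionDataOfTerms_congr_of_agree`), 11b ∕ 11c ∕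
def-T v1.7 (`Node00.Sect2FrameOfRecord`, `Sect2FormOfRecord`, `Record13CoPH`: `sect2Operand`, `sect2Slot`, `sLaw₁₃CoPH_zero`) and node00-def-K0a's `Record12LiveSelector`
(`slotsOfRecord_zero_ne_zero`: the level-0 slot `ρ₀ = exp(−A∕g₀² − E) > 0` is never the zero function).

WHY THIS FILE.  dag-n11-e's MINIMAL SUPPLY `Sect3SpliceSupplyAt θ p k` (what a [III] §3 supplier has to produce at level `k`) quantifies over EVERY exposed witness
`(t, E_k)` of the §2 form of `ρ_k` and asks, at the expansion children `s′` of PRESENT parents, (O1) the old boundary term on the child's space, (O2) r11's new-term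
obligations + analyticity for the new terms, (O3) the 𝐓-image clause for the SPLICED witness `graftAbove k (t (init s′)) (tnew s′)`.  AT `k = 0` NONE OF THIS READS THE
WITNESS: (O1) is void (`1 ≤ 0` is false); `ρ₀`'s parent slot is ALWAYS present (`slotsOfRecord_zero_ne_zero`); and 11c's slot `𝐓₁(s′) exp A₁(s′)` reads the term values at the
levels `1 … 1` only — the sums (2.25), (2.30), (2.40) run over `j ∈ [1, k]` — so `graftAbove 0 (t (init s′)) u` and `u` give THE SAME slot (§1).  Hence the level-0 supply is
EQUIVALENT to a witness-free, print-shaped statement `FirstStepSupplyAt θ p` (§2): ONE family of first-step term values `u s′` (universal in `𝐄^{(1)}`) and constants `E₁(s′)`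
such that at every expansion pair `s′ = (Ω₁ ≠ ∅, Λ₁)`: r11's `Step.LFNewTerms … 0` + analyticity of `𝐄^{(1)} ∕ 𝐑^{(1)} ∕ 𝐁^{(1)}` at level 1 ([III] Thm 2's clauses for the
first-step terms, i.e. [I] Thm 1 ∕ [II]) and the identity `𝐓ρ₀(s′) ≡ 0 ∨ 𝐓ρ₀(s′) = 𝐓₀(s′) exp A₁(s′)[u s′, E₁ s′]` a.e. on the support of `χ₁(s′)` — the first renormalization
step READ AT def-T's level-1 objects of record, with NO quantifier over exposed witnesses.

WHAT THIS FILE PROVES (1 `def … : Prop` naming the witness-free target — NOT claimed inhabited for any `θ`; theorems otherwise; 0 `sorry`, standard axioms).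
§1 generic §2 frame ∕ of record: `action23_actionDataOfTerms_congr_of_agree_pos` — (2.23) at index `k` reads the term values at the levels `1 ≤ j ≤ k` ONLY (twin of p549689's
   `…_congr_of_agree`, which asks agreement at `j = 0` too); `sect2Operand_congr_of_agree_pos`, `sect2Slot_congr_of_agree_pos` (any setting ∕ residual ∕ weights ∕ constant ∕
   background map); `sect2Slot_graftAbove_zero` — at length 1 the slot of `graftAbove 0 t u` IS the slot of `u`.
§2 `def FirstStepSupplyAt θ p : Prop`.
§3 `slotsOfRecord₁₃H_zero_ne_zero` (the level-0 parent is present at every v1.7 parameter) · ★ `sect3SpliceSupplyAt_zero_of_firstStepSupply` (`FirstStepSupplyAt θ p →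
   Sect3SpliceSupplyAt θ p 0`, `tnew := u`, (O3) rewritten by §1) · `firstStepSupplyAt_of_sect3SpliceSupplyAt_zero` (the converse, instantiating the supply at the exposed
   witness of `ρ₀` that def-T's hypothesis-free `sLaw₁₃CoPH_zero` provides) · ★★ `sect3SpliceSupplyAt_zero_iff_firstStepSupplyAt`.
§4 ★ `sLaw₁₃CoPH_one_rePinH_doorCured_theta13LiveOfRecord_of_firstStepSupply` — at the re-pinned door of K0a's cured witness of record, `ρ₁`'s §2 form at EVERY history of
   length 1 from `0 < K` + `FirstStepSupplyAt` ALONE (dag-n11-e's ★ over §3).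

HONEST FRAMING.  Count-neutral kernel bookkeeping + ONE definition naming a deliverable; `FirstStepSupplyAt` IS [I] Thm 1 + [II] (the first small-field step: the terms
`𝐄^{(1)}, 𝐑^{(1)}, 𝐁^{(1)}` with their bounds, localisation, analyticity, and the identity `𝐓ρ₀ = 𝐓₀ exp A₁`) at the objects of record — NOT proved here for any `θ`, run or
history (it is the one-carrier instantiation, NODE 00-sized); nothing of Bałaban asserted; N11 NOT discharged; K1⁷ NOT closed; counts unmoved (typed 28∕28 · discharged 5∕27).
One finite `𝕋⁴_{L^K}` programme at fixed `ε = L^{−K}`; R4 closes only the conditional finite-𝕋⁴ rung `BalabanLadder.UV` — NOT ℝ⁴, NOT OS, NOT a mass gap, NOT Clay.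
No `sorry`, no `axiom`, no `instance`, no `notation`.
Sources: [III] Theorem p.245, Thm 1 p.262, Thm 2 p.263, §2 p.262, §3 pp.264–279, (3.1) p.264, (2.17)–(2.18) p.257, (2.23)–(2.31) pp.258–260, (2.40)–(2.42) p.261, (3.24)–(3.25)
p.270; [I] Thm 1 p.258, (0.24) p.257; [II] Lemma 3 (2.38) p.20.
v1.2 (same seat, 2026-08-28; DOCSTRING-ONLY — every declaration byte-identical to v1.1 p588912): referee ref-L READ-44∕45 NIT — the 𝐓-image identity of
clause (iii) is (3.1) p.264 ∕ (3.25) p.270 (and p. 279's three new terms), not (3.67) p.283 (a step of Thm 2's proof); five cite locators corrected, nothing else.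
-/

noncomputable section

open MeasureTheory
open scoped BigOperators Matrix.Norms.L2Operator

namespace Summit.QuantumFields.YangMills.Theorems.BalabanUVNodesN11FirstStepSupply

open Literature.MathematicalPhysics.QuantumFieldTheory.Balaban1983to89 T4Continuum Node00 Node00.Tk
open Step B14.Eq227LocalizedTerms
open BalabanUVNodesN11Sect3SupplySpliceDefs
open BalabanUVNodesN11Sect3SupplySplice (sLaw₁₃CoPH_one_rePinH_doorCured_theta13LiveOfRecord_of_spliceSupply_zero)
open BalabanUVNodesN11RePinnedParamDefs (rePinH)

/-! ## §1. (2.23) at index `k` reads the term values at the levels `1 … k` only — generic frame, then the operand and the slot of record -/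

section Generic

variable {P : Params} {𝔸 : Type*} [NormedRing 𝔸] [NormedAlgebra ℂ 𝔸] [CompleteSpace 𝔸] {V : Type*} {M : ℕ} {G : Type*} [GaugeGroup G]

/-- **(2.23) AT INDEX `k` READS THE TERM VALUES AT THE LEVELS `1 ≤ j ≤ k` ONLY**: two families of term values agreeing at those levels have the same action `A_k` on the same
frame, ranges, fluctuation argument and constant — the sums (2.25), (2.30), (2.40) run over `j ∈ [1, k]` (so NOT even the level `0` is read).  Twin of dag-n11-e's
`…NoExpansionTruncatedWitness.action23_actionDataOfTerms_congr_of_agree` (agreement at all `j ≤ k`). [cite: Balaban1988Convergent, (2.23)–(2.25) pp.258–259, (2.30) p.260, (2.40) p.261] -/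
theorem action23_actionDataOfTerms_congr_of_agree_pos (S : Sect2.Setting 𝔸 G) (Rz : Sect2.Residual P 𝔸) (ν : Stage7Numerics) (g : ℕ → ℝ)
    (Ω Λ : ℕ → Set (Site P 0)) {k : ℕ} {t t' : Sect2.TermValues P 𝔸 V M}
    (hE : ∀ j, 1 ≤ j → j ≤ k → ∀ X z gc φ, t'.E j X z gc φ = t.E j X z gc φ) (hR : ∀ j, 1 ≤ j → j ≤ k → ∀ X φ, t'.R j X φ = t.R j X φ)
    (hB : ∀ j, 1 ≤ j → j ≤ k → ∀ X φ a, t'.B j X φ a = t.B j X φ a) (a : Tk.SFluct P V) (Ek : ℝ) (U : GaugeField P 0 G) :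
    (Sect2.actionDataOfTerms S Rz ν M g Ω Λ t' k a Ek).action23 k U = (Sect2.actionDataOfTerms S Rz ν M g Ω Λ t k a Ek).action23 k U := by
  rw [Sect2.action23_actionDataOfTerms, Sect2.action23_actionDataOfTerms]
  have h1 : B14.Eq225Concrete.E225 (Sect2.towerOfTerms S Rz M Ω t') (fun j X z => Sect2.admE P ν M g Λ j (Sect2.domSites P M j X) z) Rz.phi k U =
      B14.Eq225Concrete.E225 (Sect2.towerOfTerms S Rz M Ω t) (fun j X z => Sect2.admE P ν M g Λ j (Sect2.domSites P M j X) z) Rz.phi k U := by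
    unfold B14.Eq225Concrete.E225 B14.Eq225Concrete.EjSub
    refine Finset.sum_congr rfl fun j hj => ?_
    have hj1 : 1 ≤ j := (Finset.mem_Icc.mp hj).1
    have hjk : j ≤ k := (Finset.mem_Icc.mp hj).2
    simp only [Sect2.towerOfTerms, hE j hj1 hjk]
    rfl
  have h2 : B14.Eq225Concrete.R230 (Sect2.towerOfTerms S Rz M Ω t') (fun j X => Sect2.admR P ν M g Λ j (Sect2.domSites P M j X)) k U =
      B14.Eq225Concrete.R230 (Sect2.towerOfTerms S Rz M Ω t) (fun j X => Sect2.admR P ν M g Λ j (Sect2.domSites P M j X)) k U := by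
    unfold B14.Eq225Concrete.R230
    refine Finset.sum_congr rfl fun j hj => ?_
    have hj1 : 1 ≤ j := (Finset.mem_Icc.mp hj).1
    have hjk : j ≤ k := (Finset.mem_Icc.mp hj).2
    simp only [Sect2.towerOfTerms, hR j hj1 hjk]
    rfl
  have h3 : B14.Eq225Concrete.B240 (Sect2.towerOfTerms S Rz M Ω t') (fun j X => Sect2.admB P ν M g Ω Λ j (Sect2.domSites P M j X)) a k U =
      B14.Eq225Concrete.B240 (Sect2.towerOfTerms S Rz M Ω t) (fun j X => Sect2.admB P ν M g Ω Λ j (Sect2.domSites P M j X)) a k U := by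
    unfold B14.Eq225Concrete.B240
    refine Finset.sum_congr rfl fun j hj => ?_
    have hj1 : 1 ≤ j := (Finset.mem_Icc.mp hj).1
    have hjk : j ≤ k := (Finset.mem_Icc.mp hj).2
    simp only [Sect2.towerOfTerms, hB j hj1 hjk]
    rfl
  simp only [Sect2.towerOfTerms] at h1 h2 h3 ⊢
  rw [h1, h2, h3]

end Generic

section OfRecord

variable {F : T4Family} {N : ℕ} [NeZero N]
variable {𝔸 : Type*} [NormedRing 𝔸] [NormedAlgebra ℂ 𝔸] [CompleteSpace 𝔸]
variable {ν : Stage7Numerics} {M : ℕ} {g : ℕ → ℝ} {K : ℕ}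

/-- **THE OPERAND `e^{A_k(s)}` OF RECORD DOES NOT READ THE TERM VALUES OUTSIDE THE LEVELS `1 … k`** (any setting, residual, constant, background map; `k` = the length of `s`).
[cite: Balaban1988Convergent, (2.18) p.257, (2.23)–(2.25) pp.258–259, (2.30) p.260, (2.40) p.261] -/
theorem sect2Operand_congr_of_agree_pos {V : Type} (S : Sect2.Setting 𝔸 (SU N)) (Rz : Sect2.Residual (F.P K) 𝔸)
    {k : ℕ} (s : SeqOfRecord F ν M g K k) {t t' : Sect2.TermValues (F.P K) 𝔸 V M}
    (hE : ∀ j, 1 ≤ j → j ≤ k → ∀ X z gc φ, t'.E j X z gc φ = t.E j X z gc φ) (hR : ∀ j, 1 ≤ j → j ≤ k → ∀ X φ, t'.R j X φ = t.R j X φ)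
    (hB : ∀ j, 1 ≤ j → j ≤ k → ∀ X φ a, t'.B j X φ a = t.B j X φ a) (E : ℝ) (U : BgMap F N K) :
    sect2Operand F N V K S Rz s t' E U = sect2Operand F N V K S Rz s t E U := by
  funext a W
  show Real.exp ((sect2ActionDataOfRecord F N V K S Rz s t' a E).action23 k (U W)) =
    Real.exp ((sect2ActionDataOfRecord F N V K S Rz s t a E).action23 k (U W))
  rw [show (sect2ActionDataOfRecord F N V K S Rz s t' a E).action23 k (U W) = (sect2ActionDataOfRecord F N V K S Rz s t a E).action23 k (U W) from
    action23_actionDataOfTerms_congr_of_agree_pos S Rz ν g s.Ω s.Λ hE hR hB a E (U W)]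

variable (V : Type) [NormedAddCommGroup V] [InnerProductSpace ℝ V] [FiniteDimensional ℝ V] [MeasurableSpace V] [BorelSpace V]

/-- **… NOR DOES THE SLOT `𝐓_k(s) e^{A_k(s)}`** (any weight datum). [cite: Balaban1988Convergent, (2.18) p.257, (2.23) p.258] -/
theorem sect2Slot_congr_of_agree_pos (S : Sect2.Setting 𝔸 (SU N)) (Rz : Sect2.Residual (F.P K) 𝔸) (W : TkWeights F N V K)
    {k : ℕ} (s : SeqOfRecord F ν M g K k) {t t' : Sect2.TermValues (F.P K) 𝔸 V M}
    (hE : ∀ j, 1 ≤ j → j ≤ k → ∀ X z gc φ, t'.E j X z gc φ = t.E j X z gc φ) (hR : ∀ j, 1 ≤ j → j ≤ k → ∀ X φ, t'.R j X φ = t.R j X φ)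
    (hB : ∀ j, 1 ≤ j → j ≤ k → ∀ X φ a, t'.B j X φ a = t.B j X φ a) (E : ℝ) (U : BgMap F N K) :
    sect2Slot F N V K S Rz W s t' E U = sect2Slot F N V K S Rz W s t E U := by
  unfold sect2Slot
  rw [sect2Operand_congr_of_agree_pos S Rz s hE hR hB E U]

/-- **AT LENGTH 1 THE SLOT OF A GRAFT ABOVE LEVEL 0 IS THE SLOT OF THE NEW SOURCE**: `𝐓₁(s) exp A₁(s)[graftAbove 0 t u, E] = 𝐓₁(s) exp A₁(s)[u, E]` — the old (level-0)
terms of an exposed witness of `ρ₀` are never read. [cite: Balaban1988Convergent, (2.18) p.257, (2.23)–(2.25) pp.258–259, §3 p.279] -/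
theorem sect2Slot_graftAbove_zero (S : Sect2.Setting 𝔸 (SU N)) (Rz : Sect2.Residual (F.P K) 𝔸) (W : TkWeights F N V K)
    (s : SeqOfRecord F ν M g K 1) (t u : Sect2.TermValues (F.P K) 𝔸 V M) (E : ℝ) (U : BgMap F N K) :
    sect2Slot F N V K S Rz W s (graftAbove 0 t u) E U = sect2Slot F N V K S Rz W s u E U :=
  sect2Slot_congr_of_agree_pos V S Rz W s (fun _ hj1 _ X z gc φ => graftAbove_E_of_lt t u hj1 X z gc φ)
    (fun _ hj1 _ X φ => graftAbove_R_of_lt t u hj1 X φ) (fun _ hj1 _ X φ a => graftAbove_B_of_lt t u hj1 X φ a) E U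

end OfRecord

/-! ## §2. The FIRST-STEP supply: [I] Thm 1 + [II] read at def-T's level-1 objects of record, witness-free -/

section FirstStep

variable {F : T4Family} {N : ℕ} [NeZero N]

/-- **THE FIRST-STEP SUPPLY AT THE v1.7 PARAMETER `θ` FOR THE RUN `p`** — [III] §3's deliverable at level `0` in WITNESS-FREE form: first-step term values `u s′` per history
`s′ = (Ω₁, Λ₁)` of length 1, UNIVERSAL in their 𝐄-component (ONE function `𝐄^{(1)}(X, ·, z)`), and constants `E₁(s′)`, such that at every EXPANSION pair (`Ω₁(s′) ≠ ∅`):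
(i) r11's new-term obligations `Step.LFNewTerms … 0` on the tower of record along `s′` ((2.27)(i),(iii) for `𝐄^{(1)}, 𝐑^{(1)}`, the improved bounds of p. 262 for
`𝐄^{(1)}, 𝐑^{(1)}, 𝐁^{(1)}`, the RG equation at `0`); (ii) analyticity of `𝐄^{(1)}(X, ·, z)`, `𝐑^{(1)}(X, ·)` on `U^c_1(X, α_{0,1}, α_{1,1})` and of `𝐁^{(1)}(X, ·, a)` on
`Ũ^c_1(X)` ((2.27)(ii), (2.30), (2.41)(ii)); (iii) the 𝐓-IMAGE IDENTITY at `s′`: `𝐓ρ₀(s′) ≡ 0`, or `𝐓ρ₀(s′) = 𝐓₀(s′)[W(s′)] exp A₁(s′)[u s′, E₁ s′]` a.e. on the support of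
`χ₁(s′)` ([III] (3.1) ∕ (3.25) at the first step, the last integral of (3.25) written as the three new terms of p. 279 — [I] Thm 1 (0.24)–(0.27) with [II]'s cluster expansion behind it).  A PREDICATE WITH PARAMETERS naming a deliverable — NOT claimed for
any `θ`; §3 shows it is EQUIVALENT to dag-n11-e's `Sect3SpliceSupplyAt θ p 0`. [cite: Balaban1988Convergent, Thm 2 p.263, (3.1) p.264, (3.25) p.270, §3 p.279, (2.27)–(2.31) pp.259–260, (2.41)–(2.42) p.261, (2.17)–(2.18) p.257; Balaban1987RG1, Thm 1 p.258] -/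
def FirstStepSupplyAt (θ : Stage13HParams F N) (p : B12.RunParams) : Prop :=
  ∃ (u : SeqOfRecord F θ.ν θ.τ9.M (gOfRecord₁₃ F N θ.toStage13Params p) p.K 1 → Sect2.TermValues (F.P p.K) (MatA N) (FluctV N) θ.τ9.M)
    (E₁ : SeqOfRecord F θ.ν θ.τ9.M (gOfRecord₁₃ F N θ.toStage13Params p) p.K 1 → ℝ),
    Sect2.UniversalE u ∧
    ∀ s : SeqOfRecord F θ.ν θ.τ9.M (gOfRecord₁₃ F N θ.toStage13Params p) p.K 1, s.Ω 1 ≠ ∅ →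
      -- (i) r11's new-term obligations for the first-step terms on the tower of record along `s`
      Step.LFNewTerms (sect2TowerOfRecord F N (FluctV N) p.K (settingOfRecord₁₃ F N θ.toStage13Params p) (θ.rzAt p s) s (u s))
        (settingOfRecord₁₃ F N θ.toStage13Params p).lf (settingOfRecord₁₃ F N θ.toStage13Params p).βc 0 ∧
      -- (ii) analyticity of `𝐄^{(1)} ∕ 𝐑^{(1)} ∕ 𝐁^{(1)}` at level 1
      (∀ (X : (Sect2.domSys (F.P p.K) θ.τ9.M 1).Dom) (z : Site (F.P p.K) 1) (g : ℝ), 0 ≤ g → g ≤ (settingOfRecord₁₃ F N θ.toStage13Params p).lf.γ →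
        AnalyticOnNhd ℂ ((u s).E 1 X z g)
          ((sect2TowerOfRecord F N (FluctV N) p.K (settingOfRecord₁₃ F N θ.toStage13Params p) (θ.rzAt p s) s (u s)).space 1 X
            ((settingOfRecord₁₃ F N θ.toStage13Params p).lf.alpha0 ((settingOfRecord₁₃ F N θ.toStage13Params p).flow.g 1))
            ((settingOfRecord₁₃ F N θ.toStage13Params p).lf.alpha1 ((settingOfRecord₁₃ F N θ.toStage13Params p).flow.g 1)))) ∧
      (∀ X : (Sect2.domSys (F.P p.K) θ.τ9.M 1).Dom,
        AnalyticOnNhd ℂ ((u s).R 1 X)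
          ((sect2TowerOfRecord F N (FluctV N) p.K (settingOfRecord₁₃ F N θ.toStage13Params p) (θ.rzAt p s) s (u s)).space 1 X
            ((settingOfRecord₁₃ F N θ.toStage13Params p).lf.alpha0 ((settingOfRecord₁₃ F N θ.toStage13Params p).flow.g 1))
            ((settingOfRecord₁₃ F N θ.toStage13Params p).lf.alpha1 ((settingOfRecord₁₃ F N θ.toStage13Params p).flow.g 1)))) ∧
      (∀ (X : (Sect2.domSys (F.P p.K) θ.τ9.M 1).Dom) (a : SFluct (F.P p.K) (FluctV N)),
        AnalyticOnNhd ℂ (fun φ => (u s).B 1 X φ a)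
          ((sect2TowerOfRecord F N (FluctV N) p.K (settingOfRecord₁₃ F N θ.toStage13Params p) (θ.rzAt p s) s (u s)).spaceB 1 X)) ∧
      -- (iii) the 𝐓-image identity at the first step
      (slotsTOfRecord F N θ.ν θ.τ9 (EOfRecord₁₃ F N θ.toStage13Params) (wOfRecord₉ F N θ.toStage9Params) θ.ppSel p
          (gOfRecord₁₃ F N θ.toStage13Params p) 1 s = 0 ∨
        ∀ᵐ V' ∂fieldMeasure (F.P p.K) 1 (SU N),
          chiSeqOfRecord F N θ.ν θ.τ9.M (gOfRecord₁₃ F N θ.toStage13Params p) p.K 1 s V' ≠ 0 →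
            slotsTOfRecord F N θ.ν θ.τ9 (EOfRecord₁₃ F N θ.toStage13Params) (wOfRecord₉ F N θ.toStage9Params) θ.ppSel p
                (gOfRecord₁₃ F N θ.toStage13Params p) 1 s V' =
              sect2Slot F N (FluctV N) p.K (settingOfRecord₁₃ F N θ.toStage13Params p) (θ.rzAt p s) (WtOfRecord₁₃H F N θ p s) s
                (u s) (E₁ s) (UbgOfRecord₁₃CoP F N θ.toStage13Params p 1 s) V')

end FirstStep

/-! ## §3. `Sect3SpliceSupplyAt θ p 0 ↔ FirstStepSupplyAt θ p` -/

section Equivalence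

variable {F : T4Family} {N : ℕ} [NeZero N]
variable (θ : Stage13HParams F N) (p : B12.RunParams)

/-- **THE LEVEL-0 PARENT IS ALWAYS PRESENT** at a v1.7 parameter: the slot of `ρ₀ = exp(−A∕g₀² − E)` at any history of length `0` is not the zero function (node00-def-K0a's
`slotsOfRecord_zero_ne_zero` at the Stage-13 letters). [cite: Balaban1988Convergent, Thm 1 p.262, (1.11) p.248] -/
theorem slotsOfRecord₁₃H_zero_ne_zero (s₀ : SeqOfRecord F θ.ν θ.τ9.M (gOfRecord₁₃ F N θ.toStage13Params p) p.K 0) :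
    slotsOfRecord F N θ.ν θ.τ9 (EOfRecord₁₃ F N θ.toStage13Params) (wOfRecord₉ F N θ.toStage9Params) θ.ppSel p (gOfRecord₁₃ F N θ.toStage13Params p) 0 s₀ ≠ 0 :=
  slotsOfRecord_zero_ne_zero F N θ.ν θ.τ9 (EOfRecord₁₃ F N θ.toStage13Params) (wOfRecord₉ F N θ.toStage9Params) θ.ppSel p (gOfRecord₁₃ F N θ.toStage13Params p) s₀

/-- ★ **THE FIRST-STEP SUPPLY GIVES THE MINIMAL SUPPLY AT LEVEL `0`**: `FirstStepSupplyAt θ p → Sect3SpliceSupplyAt θ p 0`.  For every exposed witness `(t, E₀)` of `ρ₀`'s form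
take `tnew := u`, `EkN := E₁`: (O1) is void at `k = 0`; (O2) is clause (i)–(ii); (O3) for the spliced witness `graftAbove 0 (t (init s′)) (u s′)` IS clause (iii), the slot at
length 1 not reading the level-0 terms (`sect2Slot_graftAbove_zero`). [cite: Balaban1988Convergent, (3.1) p.264, (3.25) p.270, §3 p.279, Thm 2 p.263, (2.23)–(2.25) pp.258–259] -/
theorem sect3SpliceSupplyAt_zero_of_firstStepSupply (h : FirstStepSupplyAt θ p) : Sect3SpliceSupplyAt θ p 0 := by
  intro t Ek _
  obtain ⟨u, E₁, hu, hx⟩ := h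
  refine ⟨u, E₁, hu, fun s hs _ => ?_⟩
  obtain ⟨hnew, hanE, hanR, hanB, hcl⟩ := hx s hs
  refine ⟨fun h10 => absurd h10 (by omega), hnew, hanE, hanR, hanB, ?_⟩
  rw [sect2Slot_graftAbove_zero (FluctV N) (settingOfRecord₁₃ F N θ.toStage13Params p) (θ.rzAt p s) (WtOfRecord₁₃H F N θ p s) s (t s.init) (u s)
    (E₁ s) (UbgOfRecord₁₃CoP F N θ.toStage13Params p 1 s)]
  exact hcl

/-- **THE CONVERSE**: `Sect3SpliceSupplyAt θ p 0 → FirstStepSupplyAt θ p` — instantiate the supply at the exposed witness of `ρ₀`'s §2 form that def-T's HYPOTHESIS-FREE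
`sLaw₁₃CoPH_zero` provides (`sLaw₁₃CoPH_iff`), use the presence of the level-0 parent (`slotsOfRecord₁₃H_zero_ne_zero`) and rewrite (O3) by `sect2Slot_graftAbove_zero`.
[cite: Balaban1988Convergent, Thm 1 p.262, (3.1) p.264, (3.25) p.270, §3 p.279, (2.17)–(2.18) p.257] -/
theorem firstStepSupplyAt_of_sect3SpliceSupplyAt_zero (h : Sect3SpliceSupplyAt θ p 0) : FirstStepSupplyAt θ p := by
  obtain ⟨t, Ek, hS⟩ := (sLaw₁₃CoPH_iff F N θ p 0).mp (sLaw₁₃CoPH_zero F N θ p)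
  obtain ⟨u, E₁, hu, hx⟩ := h t Ek hS
  refine ⟨u, E₁, hu, fun s hs => ?_⟩
  obtain ⟨-, hnew, hanE, hanR, hanB, hcl⟩ := hx s hs (slotsOfRecord₁₃H_zero_ne_zero θ p s.init)
  refine ⟨hnew, hanE, hanR, hanB, ?_⟩
  rw [← sect2Slot_graftAbove_zero (FluctV N) (settingOfRecord₁₃ F N θ.toStage13Params p) (θ.rzAt p s) (WtOfRecord₁₃H F N θ p s) s (t s.init) (u s)
    (E₁ s) (UbgOfRecord₁₃CoP F N θ.toStage13Params p 1 s)]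
  exact hcl

/-- ★★ **[III] §3's MINIMAL SUPPLY AT LEVEL `0` IS EXACTLY THE WITNESS-FREE FIRST-STEP TARGET**: `Sect3SpliceSupplyAt θ p 0 ↔ FirstStepSupplyAt θ p`, generic `θ`, every run.
[cite: Balaban1988Convergent, (3.1) p.264, (3.25) p.270, §3 p.279, Thm 2 p.263; Balaban1987RG1, Thm 1 p.258] -/
theorem sect3SpliceSupplyAt_zero_iff_firstStepSupplyAt : Sect3SpliceSupplyAt θ p 0 ↔ FirstStepSupplyAt θ p :=
  ⟨firstStepSupplyAt_of_sect3SpliceSupplyAt_zero θ p, sect3SpliceSupplyAt_zero_of_firstStepSupply θ p⟩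

end Equivalence

/-! ## §4. `ρ₁`'s §2 form at the re-pinned door of the cured witness of record from the first-step supply and `0 < K` alone -/

section Faces

variable (F : T4Family) (N : ℕ) [NeZero N]

/-- ★ **`ρ₁`'s §2 FORM AT THE RE-PINNED DOOR OF THE CURED WITNESS OF RECORD, EVERY HISTORY OF LENGTH 1, FROM `FirstStepSupplyAt` AND `0 < K` — NOTHING ELSE**: dag-n11-e's
`sLaw₁₃CoPH_one_rePinH_doorCured_theta13LiveOfRecord_of_spliceSupply_zero` over §3.  The displayed hypothesis IS the first renormalization step ([I] Thm 1 + [II]) at the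
objects of record — the remaining content of N11's level-1 slot there. [cite: Balaban1988Convergent, Thm 1 p.262, Theorem p.245, Thm 2 p.263, §3 p.279, (3.24)–(3.25) p.270; Balaban1987RG1, Thm 1 p.258; Balaban1989LargeFieldI, (0.3)–(0.4) p.176] -/
theorem sLaw₁₃CoPH_one_rePinH_doorCured_theta13LiveOfRecord_of_firstStepSupply (p : B12.RunParams) (hK : 0 < p.K)
    (h : FirstStepSupplyAt (rePinH (Stage13HParams.ofHistoryBlind F N (Stage13RParams.ofCured F N (theta13LiveOfRecord F N)))) p) :
    SLaw₁₃CoPH F N (rePinH (Stage13HParams.ofHistoryBlind F N (Stage13RParams.ofCured F N (theta13LiveOfRecord F N)))) p 1 :=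
  sLaw₁₃CoPH_one_rePinH_doorCured_theta13LiveOfRecord_of_spliceSupply_zero F N p hK (sect3SpliceSupplyAt_zero_of_firstStepSupply _ p h)

end Faces

/-! ## §5 (v1.1). The first-step supply UNFOLDED to def-T's level-1 objects: the explicit transport identity of the first step

v1.1 (same seat, 2026-08-28; APPEND-ONLY — §1–§4 byte-identical; dag-n11-e g15's «X2 OFFER», INBOX 2026-08-27T23:51:53Z).  Clause (iii) of `FirstStepSupplyAt`
reads def-T's slot families abstractly (`slotsTOfRecord … 1 s`, 11c's `sect2Slot`).  Here it is REWRITTEN in def-T's letters so that NODE 00 sees the level-0 supply as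
an explicit identity between its own objects: by def-T's (†) `slotsTOfRecord_succ_apply` at `k = 0`, `χ₀ ≡ 1` (`chiSeqOfRecord_zero`) and `slot₀ = ρ₀`
(`texpAOfRecord_zero`), the pre-𝐑 slot of `𝐓ρ₀` at a pair `s = (Ω₁, Λ₁)` IS the one-step transport of record of the weighted start,
`𝐓ρ₀(s)(V′) = transportOfRecord F N K 0 (U ↦ w₀(s)(U, V′) · ρ₀(U)) V′`, `ρ₀ = e^{−E} · exp[−(1∕g₀²)A]` (`rhoZeroOfRecord`); and 11c's slot is `𝐓₁(s)[W] (exp A₁(s)[u s, E₁ s])`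
(`sect2Slot = TkOfRecord … (sect2Operand …)`, `rfl`).  Nothing else changes. -/

section IntegralIdentity

variable {F : T4Family} {N : ℕ} [NeZero N]
variable (θ : Stage13HParams F N) (p : B12.RunParams)

/-- **THE LEVEL-0 POST-𝐑 SLOT OF RECORD IS THE START `ρ₀ = e^{−E(p)}·exp[−(1∕g₀²)A]`** at every history of length `0` (def-T's `slotsOfRecord` at level `0` is
`texpAOfRecord … 0 = rhoZeroOfRecord`, `rfl`). [cite: Balaban1988Convergent, Thm 1 p.262, (2.18) p.257 (bookkeeping)] -/
theorem slotsOfRecord₁₃H_zero_eq_rhoZero (s₀ : SeqOfRecord F θ.ν θ.τ9.M (gOfRecord₁₃ F N θ.toStage13Params p) p.K 0) :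
    slotsOfRecord F N θ.ν θ.τ9 (EOfRecord₁₃ F N θ.toStage13Params) (wOfRecord₉ F N θ.toStage9Params) θ.ppSel p (gOfRecord₁₃ F N θ.toStage13Params p) 0 s₀ =
      rhoZeroOfRecord F N p.K (gOfRecord₁₃ F N θ.toStage13Params p 0) (EOfRecord₁₃ F N θ.toStage13Params p) :=
  rfl

/-- **THE PRE-𝐑 SLOT OF `𝐓ρ₀` AT A PAIR `s = (Ω₁, Λ₁)`, UNFOLDED**: `𝐓ρ₀(s)(V′) = transportOfRecord F N K 0 (U ↦ w₀(s)(U, V′) · ρ₀(U)) V′` — def-T's (†)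
`slotsTOfRecord_succ_apply` at `k = 0` with `χ₀ ≡ 1` (`chiSeqOfRecord_zero`) and `slot₀ = ρ₀`. [cite: Balaban1988Convergent, (3.1) p.264, (3.24)–(3.25) p.270, Thm 1 p.262] -/
theorem slotsTOfRecord₁₃H_one_apply (s : SeqOfRecord F θ.ν θ.τ9.M (gOfRecord₁₃ F N θ.toStage13Params p) p.K 1)
    (V' : GaugeField (F.P p.K) 1 (SU N)) :
    slotsTOfRecord F N θ.ν θ.τ9 (EOfRecord₁₃ F N θ.toStage13Params) (wOfRecord₉ F N θ.toStage9Params) θ.ppSel p (gOfRecord₁₃ F N θ.toStage13Params p) 1 s V' =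
      transportOfRecord F N p.K 0 (fun U => wOfRecord₉ F N θ.toStage9Params p (gOfRecord₁₃ F N θ.toStage13Params p) 0 s U V' *
        rhoZeroOfRecord F N p.K (gOfRecord₁₃ F N θ.toStage13Params p 0) (EOfRecord₁₃ F N θ.toStage13Params p) U) V' := by
  rw [slotsTOfRecord_succ_apply]
  congr 1
  funext U
  rw [chiSeqOfRecord_zero, one_mul]
  rfl

/-- **11c's §2-FORM SLOT IS `𝐓_k(s)[W]` APPLIED TO THE OPERAND `exp A_k(s)`** (`sect2Slot = TkOfRecord … (sect2Operand …)`, `rfl`). [cite: Balaban1988Convergent, (2.18) p.257, (2.23) p.258 (bookkeeping)] -/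
theorem sect2Slot_eq_TkOfRecord_sect2Operand {V : Type} [NormedAddCommGroup V] [InnerProductSpace ℝ V] [FiniteDimensional ℝ V] [MeasurableSpace V] [BorelSpace V]
    {𝔸 : Type*} [NormedRing 𝔸] [NormedAlgebra ℂ 𝔸] [CompleteSpace 𝔸] {ν : Stage7Numerics} {M : ℕ} {g : ℕ → ℝ} {K : ℕ}
    (S : Sect2.Setting 𝔸 (SU N)) (Rz : Sect2.Residual (F.P K) 𝔸) (W : TkWeights F N V K) {k : ℕ} (s : SeqOfRecord F ν M g K k)
    (t : Sect2.TermValues (F.P K) 𝔸 V M) (E : ℝ) (U : BgMap F N K) :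
    sect2Slot F N V K S Rz W s t E U = TkOfRecord F N V ν M g K W k s (sect2Operand F N V K S Rz s t E U) := rfl

/-- **THE FIRST-STEP SUPPLY IN def-T's LETTERS** — `FirstStepSupplyAt θ p` with clause (iii) written as the EXPLICIT TRANSPORT IDENTITY of the first renormalization step:
for first-step term values `u s` (universal in `𝐄^{(1)}`) and constants `E₁ s`, at every expansion pair `s = (Ω₁ ≠ ∅, Λ₁)`: (i) r11's new-term obligations, (ii) analyticity
at level 1, and (iii′) EITHER the transported weighted start `V′ ↦ transportOfRecord F N K 0 (U ↦ w₀(s)(U,V′)·ρ₀(U)) V′` is the zero function, OR for `dV′`-a.e. `V′` on the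
support of `χ₁(s)`: `transportOfRecord F N K 0 (U ↦ w₀(s)(U,V′)·ρ₀(U)) V′ = 𝐓₁(s)[W(s)] (exp A₁(s)[u s, E₁ s]) (V′)` — [I] Thm 1's first step `𝐓ρ₀ = 𝐓₁ exp A₁` at the
objects of record (`ρ₀ = rhoZeroOfRecord`, `transportOfRecord` = the kernel transport along Bałaban's averaging of record, `TkOfRecord` = 11a's `𝐓_k(s)[W]`, `sect2Operand` =
`exp A₁(s)` read at the background map of record).  A predicate naming a deliverable — NOT claimed for any `θ`. [cite: Balaban1988Convergent, (3.1) p.264, (3.24)–(3.25) p.270, (2.18) p.257, (2.23) p.258, §3 p.279; Balaban1987RG1, Thm 1 p.258, (0.24)–(0.27) p.257] -/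
def FirstStepIntegralIdentityAt (θ : Stage13HParams F N) (p : B12.RunParams) : Prop :=
  ∃ (u : SeqOfRecord F θ.ν θ.τ9.M (gOfRecord₁₃ F N θ.toStage13Params p) p.K 1 → Sect2.TermValues (F.P p.K) (MatA N) (FluctV N) θ.τ9.M)
    (E₁ : SeqOfRecord F θ.ν θ.τ9.M (gOfRecord₁₃ F N θ.toStage13Params p) p.K 1 → ℝ),
    Sect2.UniversalE u ∧
    ∀ s : SeqOfRecord F θ.ν θ.τ9.M (gOfRecord₁₃ F N θ.toStage13Params p) p.K 1, s.Ω 1 ≠ ∅ →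
      Step.LFNewTerms (sect2TowerOfRecord F N (FluctV N) p.K (settingOfRecord₁₃ F N θ.toStage13Params p) (θ.rzAt p s) s (u s))
        (settingOfRecord₁₃ F N θ.toStage13Params p).lf (settingOfRecord₁₃ F N θ.toStage13Params p).βc 0 ∧
      (∀ (X : (Sect2.domSys (F.P p.K) θ.τ9.M 1).Dom) (z : Site (F.P p.K) 1) (g : ℝ), 0 ≤ g → g ≤ (settingOfRecord₁₃ F N θ.toStage13Params p).lf.γ →
        AnalyticOnNhd ℂ ((u s).E 1 X z g)
          ((sect2TowerOfRecord F N (FluctV N) p.K (settingOfRecord₁₃ F N θ.toStage13Params p) (θ.rzAt p s) s (u s)).space 1 X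
            ((settingOfRecord₁₃ F N θ.toStage13Params p).lf.alpha0 ((settingOfRecord₁₃ F N θ.toStage13Params p).flow.g 1))
            ((settingOfRecord₁₃ F N θ.toStage13Params p).lf.alpha1 ((settingOfRecord₁₃ F N θ.toStage13Params p).flow.g 1)))) ∧
      (∀ X : (Sect2.domSys (F.P p.K) θ.τ9.M 1).Dom,
        AnalyticOnNhd ℂ ((u s).R 1 X)
          ((sect2TowerOfRecord F N (FluctV N) p.K (settingOfRecord₁₃ F N θ.toStage13Params p) (θ.rzAt p s) s (u s)).space 1 X
            ((settingOfRecord₁₃ F N θ.toStage13Params p).lf.alpha0 ((settingOfRecord₁₃ F N θ.toStage13Params p).flow.g 1))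
            ((settingOfRecord₁₃ F N θ.toStage13Params p).lf.alpha1 ((settingOfRecord₁₃ F N θ.toStage13Params p).flow.g 1)))) ∧
      (∀ (X : (Sect2.domSys (F.P p.K) θ.τ9.M 1).Dom) (a : SFluct (F.P p.K) (FluctV N)),
        AnalyticOnNhd ℂ (fun φ => (u s).B 1 X φ a)
          ((sect2TowerOfRecord F N (FluctV N) p.K (settingOfRecord₁₃ F N θ.toStage13Params p) (θ.rzAt p s) s (u s)).spaceB 1 X)) ∧
      -- (iii′) the transport identity of the first step, in def-T's letters
      ((fun V' : GaugeField (F.P p.K) 1 (SU N) =>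
          transportOfRecord F N p.K 0 (fun U => wOfRecord₉ F N θ.toStage9Params p (gOfRecord₁₃ F N θ.toStage13Params p) 0 s U V' *
            rhoZeroOfRecord F N p.K (gOfRecord₁₃ F N θ.toStage13Params p 0) (EOfRecord₁₃ F N θ.toStage13Params p) U) V') = 0 ∨
        ∀ᵐ V' ∂fieldMeasure (F.P p.K) 1 (SU N),
          chiSeqOfRecord F N θ.ν θ.τ9.M (gOfRecord₁₃ F N θ.toStage13Params p) p.K 1 s V' ≠ 0 →
            transportOfRecord F N p.K 0 (fun U => wOfRecord₉ F N θ.toStage9Params p (gOfRecord₁₃ F N θ.toStage13Params p) 0 s U V' *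
                rhoZeroOfRecord F N p.K (gOfRecord₁₃ F N θ.toStage13Params p 0) (EOfRecord₁₃ F N θ.toStage13Params p) U) V' =
              TkOfRecord F N (FluctV N) θ.ν θ.τ9.M (gOfRecord₁₃ F N θ.toStage13Params p) p.K (WtOfRecord₁₃H F N θ p s) 1 s
                (sect2Operand F N (FluctV N) p.K (settingOfRecord₁₃ F N θ.toStage13Params p) (θ.rzAt p s) s (u s) (E₁ s)
                  (UbgOfRecord₁₃CoP F N θ.toStage13Params p 1 s)) V')

/-- The pre-𝐑 slot of `𝐓ρ₀` at a pair, as a FUNCTION of the new field: `𝐓ρ₀(s) = V′ ↦ transportOfRecord F N K 0 (U ↦ w₀(s)(U,V′)·ρ₀(U)) V′`.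
[cite: Balaban1988Convergent, (3.1) p.264, (3.25) p.270 (bookkeeping)] -/
theorem slotsTOfRecord₁₃H_one_eq (s : SeqOfRecord F θ.ν θ.τ9.M (gOfRecord₁₃ F N θ.toStage13Params p) p.K 1) :
    slotsTOfRecord F N θ.ν θ.τ9 (EOfRecord₁₃ F N θ.toStage13Params) (wOfRecord₉ F N θ.toStage9Params) θ.ppSel p (gOfRecord₁₃ F N θ.toStage13Params p) 1 s =
      fun V' => transportOfRecord F N p.K 0 (fun U => wOfRecord₉ F N θ.toStage9Params p (gOfRecord₁₃ F N θ.toStage13Params p) 0 s U V' *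
        rhoZeroOfRecord F N p.K (gOfRecord₁₃ F N θ.toStage13Params p 0) (EOfRecord₁₃ F N θ.toStage13Params p) U) V' :=
  funext fun V' => slotsTOfRecord₁₃H_one_apply θ p s V'

/-- ★ **`FirstStepSupplyAt θ p ↔ FirstStepIntegralIdentityAt θ p`** — the witness-free first-step supply IS the explicit transport identity of the first step in def-T's
letters (pure rewriting: `slotsTOfRecord₁₃H_one_eq`, `sect2Slot = TkOfRecord ∘ sect2Operand`). [cite: Balaban1988Convergent, (3.1) p.264, (3.24)–(3.25) p.270, (2.18) p.257, §3 p.279; Balaban1987RG1, Thm 1 p.258] -/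
theorem firstStepSupplyAt_iff_integralIdentity : FirstStepSupplyAt θ p ↔ FirstStepIntegralIdentityAt θ p := by
  unfold FirstStepSupplyAt FirstStepIntegralIdentityAt
  refine exists_congr fun u => exists_congr fun E₁ => and_congr_right fun _ => forall_congr' fun s => forall_congr' fun _ => ?_
  refine and_congr_right fun _ => and_congr_right fun _ => and_congr_right fun _ => and_congr_right fun _ => ?_
  rw [slotsTOfRecord₁₃H_one_eq θ p s]
  exact Iff.rfl

/-- ★★ **[III] §3's MINIMAL SUPPLY AT LEVEL `0` IS THE EXPLICIT FIRST-STEP TRANSPORT IDENTITY**: `Sect3SpliceSupplyAt θ p 0 ↔ FirstStepIntegralIdentityAt θ p` (generic `θ`,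
every run). [cite: Balaban1988Convergent, §3 p.279, (3.1) p.264, (3.25) p.270, Thm 2 p.263; Balaban1987RG1, Thm 1 p.258] -/
theorem sect3SpliceSupplyAt_zero_iff_integralIdentity : Sect3SpliceSupplyAt θ p 0 ↔ FirstStepIntegralIdentityAt θ p :=
  (sect3SpliceSupplyAt_zero_iff_firstStepSupplyAt θ p).trans (firstStepSupplyAt_iff_integralIdentity θ p)

variable (F N)

/-- ★ **`ρ₁`'s §2 FORM AT THE RE-PINNED DOOR OF THE CURED WITNESS OF RECORD FROM THE FIRST-STEP TRANSPORT IDENTITY AND `0 < K` ALONE** (§4 over the iff of this section).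
[cite: Balaban1988Convergent, Thm 1 p.262, Theorem p.245, (3.1) p.264, (3.24)–(3.25) p.270, §3 p.279; Balaban1987RG1, Thm 1 p.258] -/
theorem sLaw₁₃CoPH_one_rePinH_doorCured_theta13LiveOfRecord_of_integralIdentity (p : B12.RunParams) (hK : 0 < p.K)
    (h : FirstStepIntegralIdentityAt (rePinH (Stage13HParams.ofHistoryBlind F N (Stage13RParams.ofCured F N (theta13LiveOfRecord F N)))) p) :
    SLaw₁₃CoPH F N (rePinH (Stage13HParams.ofHistoryBlind F N (Stage13RParams.ofCured F N (theta13LiveOfRecord F N)))) p 1 :=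
  sLaw₁₃CoPH_one_rePinH_doorCured_theta13LiveOfRecord_of_firstStepSupply F N p hK ((firstStepSupplyAt_iff_integralIdentity _ p).mpr h)

end IntegralIdentity

end Summit.QuantumFields.YangMills.Theorems.BalabanUVNodesN11FirstStepSupply

end
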